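import Literature.Probability.RandomPlanarGeometry.HexSAWArcDecomposition
import HarnessLib

/-!
# The fibre of a group index: the bijection with arcs, recognising the cut, and the weighted domain-Markov inequality

Continuation of `HexSAWArcDecomposition.lean` (two-sided domain Markov property of the
hexagonal-lattice SAW measure `P ∝ x^{#vertices}`, Duminil-Copin–Smirnov 2012 §2, as list
surgery; no new definitions):

* `sum_fibre_eq_sum_arcs` — for a fixed GROUP INDEX `(β₀, p₀, c₁, c_L, p₀', β₀')`, any function of
  the support summed over the SAWs of `Ω_δ` whose support reads `β₀ ++ p₀ :: (c ++ p₀' :: β₀')`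
  (`head c = c₁`, `last c = c_L`) equals the same function of the glued list summed over the arcs
  `{p₀, c₁} → {c_L, p₀'}` using edges of `Ω_δ` (cutting/gluing is a bijection);
* `takeWhile_eq_of_decomp`, `dropWhile_eq_of_decomp`, `reverse_takeWhile_reverse_eq_of_decomp`,
  `reverse_dropWhile_reverse_eq_of_decomp`, `dropLast_dropWhile_eq_of_decomp` — if a list reads
  `β₀ ++ p₀ :: (c ++ p₀' :: β₀')` with `β₀ ++ [p₀]`, `p₀' :: β₀'` satisfying a Boolean predicate `p`
  ("far") and the end points of `c ≠ []` failing it, then the maximal `p`-prefix is `β₀ ++ [p₀]`,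
  the rest is `c ++ p₀' :: β₀'`, its maximal `p`-suffix is `p₀' :: β₀'` and the middle is `c`
  (so the group index of a glued walk is the group index one started from);
* `sum_fibre_event_le` — **the weighted inequality**: if an event `E` on supports implies an
  event `A` on the arc of the middle piece, and the `x`-mass of the arcs satisfying `A` is at most
  `C` times the `x`-mass of all arcs of the group, then the `x^{#vertices}`-mass of the SAWs of the
  fibre satisfying `E` is at most `C` times the mass of the fibre.

Deliberately NOT here: any specific event; measures.
-/

noncomputable section

open scoped Classical
open Literature.Probability.LatticeModels

namespace Literature.Probability.RandomPlanarGeometry.SAW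

/-! ### The fibre of a group index is in bijection with the arcs -/

section Fibre

variable {Ω : Set ℂ} {δ : ℝ} {a b : HexVertex}

/-- **Two-sided domain Markov property as an identity of finite sums.** Fix a GROUP INDEX
`(β₀, p₀, c₁, c_L, p₀', β₀')` witnessed by a SAW `ω₀` of `Ω_δ` from `a` to `b` (support
`β₀ ++ p₀ :: (c₀ ++ p₀' :: β₀')`, `head c₀ = c₁`, `last c₀ = c_L`), and a vertex set `Λ₀` containing
the support of every SAW from `a` to `b`. Then cutting/gluing is a bijection between the SAWs whose
support reads `β₀ ++ p₀ :: (c ++ p₀' :: β₀')` with `head c = c₁`, `last c = c_L`, and the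
self-avoiding mid-edge arcs of `Λ₀ ∖ (β₀ ++ [p₀]) ∖ (p₀' :: β₀')` from `{p₀, c₁}` to `{c_L, p₀'}` using
only edges of `Ω_δ`: every function of the support has the same sum over both.
[cite: DuminilCopinSmirnov2012, §2 (walks between mid-edges)] -/
theorem sum_fibre_eq_sum_arcs [Fintype (HexDomainSAW Ω δ a b)] (ω₀ : HexDomainSAW Ω δ a b)
    {β₀ c₀ β₀' : List HexVertex} {p₀ p₀' c₁ c_L : HexVertex} (hc₀ : c₀ ≠ [])
    (h₀ : ω₀.walk.support = β₀ ++ p₀ :: (c₀ ++ p₀' :: β₀')) (hc₁ : c₀.head hc₀ = c₁)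
    (hcL : c₀.getLast hc₀ = c_L) (Λ₀ : Finset HexVertex)
    (hΛ₀ : ∀ (ω : HexDomainSAW Ω δ a b), ∀ v ∈ ω.walk.support, v ∈ Λ₀) (w : List HexVertex → ℝ) :
    ∑ ω ∈ (Finset.univ : Finset (HexDomainSAW Ω δ a b)).filter (fun ω => ∃ c : List HexVertex,
        ∃ hc : c ≠ [], ω.walk.support = β₀ ++ p₀ :: (c ++ p₀' :: β₀') ∧ c.head hc = c₁ ∧
          c.getLast hc = c_L), w ω.walk.support =
      ∑ α ∈ (Finset.univ : Finset (HexMidEdgeSAW ((Λ₀ \ (β₀ ++ [p₀]).toFinset) \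
        (p₀' :: β₀').toFinset) s(p₀, c₁) s(c_L, p₀'))).filter
          (fun α => α.verts.IsChain (hexDomainGraph Ω δ).Adj),
        w (β₀ ++ p₀ :: (α.verts ++ p₀' :: β₀')) := by
  set Λ' := (Λ₀ \ (β₀ ++ [p₀]).toFinset) \ (p₀' :: β₀').toFinset with hΛ'
  set S := (Finset.univ : Finset (HexDomainSAW Ω δ a b)).filter (fun ω => ∃ c : List HexVertex,
    ∃ hc : c ≠ [], ω.walk.support = β₀ ++ p₀ :: (c ++ p₀' :: β₀') ∧ c.head hc = c₁ ∧
      c.getLast hc = c_L) with hS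
  set T := (Finset.univ : Finset (HexMidEdgeSAW Λ' s(p₀, c₁) s(c_L, p₀'))).filter
    (fun α => α.verts.IsChain (hexDomainGraph Ω δ).Adj) with hT
  -- append cancellation
  have hcancel : ∀ c c' : List HexVertex,
      β₀ ++ p₀ :: (c ++ p₀' :: β₀') = β₀ ++ p₀ :: (c' ++ p₀' :: β₀') → c = c' := by
    intro c c' h
    have h1 := List.append_cancel_left h
    rw [List.cons.injEq] at h1
    exact List.append_cancel_right h1.2
  -- the cut map on members of `S`
  have hmemS : ∀ ω ∈ S, ∃ c : List HexVertex, ∃ hc : c ≠ [],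
      ω.walk.support = β₀ ++ p₀ :: (c ++ p₀' :: β₀') ∧ c.head hc = c₁ ∧ c.getLast hc = c_L :=
    fun ω hω => (Finset.mem_filter.1 hω).2
  have hcut : ∀ ω ∈ S, ∃ α : HexMidEdgeSAW Λ' s(p₀, c₁) s(c_L, p₀'),
      ω.walk.support = β₀ ++ p₀ :: (α.verts ++ p₀' :: β₀') ∧
        α.verts.IsChain (hexDomainGraph Ω δ).Adj := by
    intro ω hω
    obtain ⟨c, hc, hL, h1, h2⟩ := hmemS ω hω
    obtain ⟨α, hαc, hαchain⟩ := exists_hexMidEdgeSAW_of_support_eq ω Λ₀ (hΛ₀ ω) hc hL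
    subst h1; subst h2
    exact ⟨α, hαc.symm ▸ hL, hαchain⟩
  choose cut hcut_supp hcut_chain using hcut
  haveI : Nonempty (HexDomainSAW Ω δ a b) := ⟨ω₀⟩
  -- the glue map on members of `T`
  have hglue : ∀ α ∈ T, ∃ ω : HexDomainSAW Ω δ a b, ∃ hne : α.verts ≠ [],
      ω.walk.support = β₀ ++ p₀ :: (α.verts ++ p₀' :: β₀') ∧ α.verts.head hne = c₁ ∧
        α.verts.getLast hne = c_L := fun α hα =>
    exists_hexDomainSAW_of_hexMidEdgeSAW ω₀ hc₀ h₀ hc₁ hcL α (Finset.mem_filter.1 hα).2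
  choose! glue hglue using hglue
  refine Finset.sum_bij' (fun ω hω => cut ω hω) (fun α hα => glue α) ?_ ?_ ?_ ?_ ?_
  · intro ω hω
    exact Finset.mem_filter.2 ⟨Finset.mem_univ _, hcut_chain ω hω⟩
  · intro α hα
    obtain ⟨hne, hsupp, hh, hl⟩ := hglue α hα
    exact Finset.mem_filter.2 ⟨Finset.mem_univ _, α.verts, hne, hsupp, hh, hl⟩
  · intro ω hω
    apply hexDomainSAW_eq_of_support_eq
    have hmem : cut ω hω ∈ T := Finset.mem_filter.2 ⟨Finset.mem_univ _, hcut_chain ω hω⟩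
    obtain ⟨-, hsupp, -, -⟩ := hglue (cut ω hω) hmem
    rw [hsupp, ← hcut_supp ω hω]
  · intro α hα
    obtain ⟨hne, hsupp, hh, hl⟩ := hglue α hα
    have hmem : glue α ∈ S := Finset.mem_filter.2 ⟨Finset.mem_univ _, α.verts, hne, hsupp, hh, hl⟩
    apply HexMidEdgeSAW.ext
    exact hcancel _ _ ((hcut_supp _ hmem).symm.trans hsupp)
  · intro ω hω
    simp only [hcut_supp ω hω]

end Fibre

/-! ### Recognising the maximal far prefix / suffix of a glued list -/

section Recognise

variable {V : Type*} (p : V → Bool) {β₀ c β₀' : List V} {p₀ p₀' : V}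

/-- The maximal `p`-prefix of `β₀ ++ p₀ :: (c ++ X)` is `β₀ ++ [p₀]` when these satisfy `p` and
the head of `c ≠ []` does not. [folklore] -/
theorem takeWhile_eq_of_decomp (X : List V) (hc : c ≠ []) (hβ : ∀ v ∈ β₀ ++ [p₀], p v = true)
    (hc₁ : p (c.head hc) = false) :
    (β₀ ++ p₀ :: (c ++ X)).takeWhile p = β₀ ++ [p₀] := by
  obtain ⟨c₁, c', rfl⟩ := List.exists_cons_of_ne_nil hc
  have e : β₀ ++ p₀ :: (c₁ :: c' ++ X) = (β₀ ++ [p₀]) ++ (c₁ :: (c' ++ X)) := by simp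
  rw [e, List.takeWhile_append_of_pos hβ, List.takeWhile_cons_of_neg (by simpa using hc₁),
    List.append_nil]

/-- The rest after the maximal `p`-prefix of `β₀ ++ p₀ :: (c ++ X)` is `c ++ X`. [folklore] -/
theorem dropWhile_eq_of_decomp (X : List V) (hc : c ≠ []) (hβ : ∀ v ∈ β₀ ++ [p₀], p v = true)
    (hc₁ : p (c.head hc) = false) :
    (β₀ ++ p₀ :: (c ++ X)).dropWhile p = c ++ X := by
  obtain ⟨c₁, c', rfl⟩ := List.exists_cons_of_ne_nil hc
  have e : β₀ ++ p₀ :: (c₁ :: c' ++ X) = (β₀ ++ [p₀]) ++ (c₁ :: (c' ++ X)) := by simp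
  rw [e, List.dropWhile_append_of_pos hβ, List.dropWhile_cons_of_neg (by simpa using hc₁)]
  simp

/-- The maximal `p`-suffix of `c ++ p₀' :: β₀'` is `p₀' :: β₀'` when these satisfy `p` and the last
element of `c ≠ []` does not. [folklore] -/
theorem reverse_takeWhile_reverse_eq_of_decomp (hc : c ≠ [])
    (hβ' : ∀ v ∈ p₀' :: β₀', p v = true) (hcL : p (c.getLast hc) = false) :
    ((c ++ p₀' :: β₀').reverse.takeWhile p).reverse = p₀' :: β₀' := by
  have hne : c.reverse ≠ [] := by simpa using hc
  obtain ⟨cL, c', hc'⟩ := List.exists_cons_of_ne_nil hne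
  have hcL' : p cL = false := by
    have : c.reverse.head hne = cL := by simp [hc']
    rw [List.head_reverse] at this
    rw [← this]; exact hcL
  rw [List.reverse_append, List.reverse_cons, List.takeWhile_append_of_pos (by
    intro v hv; exact hβ' v (by simpa [or_comm] using hv)), hc',
    List.takeWhile_cons_of_neg (by simp [hcL']), List.append_nil, List.reverse_append]
  simp

/-- The middle piece of `c ++ p₀' :: β₀'` (what is left after removing the maximal `p`-suffix) is
`c`. [folklore] -/
theorem reverse_dropWhile_reverse_eq_of_decomp (hc : c ≠ [])
    (hβ' : ∀ v ∈ p₀' :: β₀', p v = true) (hcL : p (c.getLast hc) = false) :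
    ((c ++ p₀' :: β₀').reverse.dropWhile p).reverse = c := by
  have hne : c.reverse ≠ [] := by simpa using hc
  obtain ⟨cL, c', hc'⟩ := List.exists_cons_of_ne_nil hne
  have hcL' : p cL = false := by
    have : c.reverse.head hne = cL := by simp [hc']
    rw [List.head_reverse] at this
    rw [← this]; exact hcL
  rw [List.reverse_append, List.reverse_cons, List.dropWhile_append_of_pos (by
    intro v hv; exact hβ' v (by simpa [or_comm] using hv)), hc',
    List.dropWhile_cons_of_neg (by simp [hcL']), ← hc', List.reverse_reverse]

/-- Rooted version: the rest `c ++ [b]` without its last element is `c`. [folklore] -/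
theorem dropLast_dropWhile_eq_of_decomp (b : V) (hc : c ≠ []) (hβ : ∀ v ∈ β₀ ++ [p₀], p v = true)
    (hc₁ : p (c.head hc) = false) :
    ((β₀ ++ p₀ :: (c ++ [b])).dropWhile p).dropLast = c := by
  rw [dropWhile_eq_of_decomp p [b] hc hβ hc₁, List.dropLast_concat]

end Recognise

/-! ### The weighted domain-Markov inequality on a fibre -/

section FibreBound

variable {Ω : Set ℂ} {δ : ℝ} {a b : HexVertex}

/-- The length of a glued support. [folklore] -/
theorem length_glued (β₀ c β₀' : List HexVertex) (p₀ p₀' : HexVertex) :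
    (β₀ ++ p₀ :: (c ++ p₀' :: β₀')).length = (β₀.length + β₀'.length + 2) + c.length := by
  simp only [List.length_append, List.length_cons]
  ring

/-- **The weighted two-sided domain-Markov inequality.** In the setting of
`sum_fibre_eq_sum_arcs` (group index `(β₀, p₀, c₁, c_L, p₀', β₀')` witnessed by `ω₀`), let `E` be an
event on supports and `A` an event on the arcs `{p₀, c₁} → {c_L, p₀'}` of
`Λ' = Λ₀ ∖ (β₀ ++ [p₀]) ∖ (p₀' :: β₀')` such that `E` of a glued support implies `A` of its arc (for
arcs using edges of `Ω_δ`). If the `x`-mass `Σ x^{ℓ}` of the arcs using edges of `Ω_δ` and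
satisfying `A` is at most `C` times that of all arcs using edges of `Ω_δ`, then the
`x^{#vertices}`-mass of the SAWs of the fibre satisfying `E` is at most `C` times the mass of the
whole fibre (`x ≥ 0`). [cite: DuminilCopinSmirnov2012, §2 (walks between mid-edges)] -/
theorem sum_fibre_event_le [Fintype (HexDomainSAW Ω δ a b)] (ω₀ : HexDomainSAW Ω δ a b)
    {β₀ c₀ β₀' : List HexVertex} {p₀ p₀' c₁ c_L : HexVertex} (hc₀ : c₀ ≠ [])
    (h₀ : ω₀.walk.support = β₀ ++ p₀ :: (c₀ ++ p₀' :: β₀')) (hc₁ : c₀.head hc₀ = c₁)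
    (hcL : c₀.getLast hc₀ = c_L) (Λ₀ : Finset HexVertex)
    (hΛ₀ : ∀ (ω : HexDomainSAW Ω δ a b), ∀ v ∈ ω.walk.support, v ∈ Λ₀)
    (E : List HexVertex → Prop)
    (A : HexMidEdgeSAW ((Λ₀ \ (β₀ ++ [p₀]).toFinset) \ (p₀' :: β₀').toFinset) s(p₀, c₁) s(c_L, p₀') →
      Prop)
    (hEA : ∀ α : HexMidEdgeSAW ((Λ₀ \ (β₀ ++ [p₀]).toFinset) \ (p₀' :: β₀').toFinset) s(p₀, c₁)
      s(c_L, p₀'), α.verts.IsChain (hexDomainGraph Ω δ).Adj →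
        E (β₀ ++ p₀ :: (α.verts ++ p₀' :: β₀')) → A α)
    {x C : ℝ} (hx : 0 ≤ x)
    (hAC : ∑ α : HexMidEdgeSAW ((Λ₀ \ (β₀ ++ [p₀]).toFinset) \ (p₀' :: β₀').toFinset) s(p₀, c₁)
        s(c_L, p₀'), (if α.verts.IsChain (hexDomainGraph Ω δ).Adj ∧ A α then x ^ α.length else 0) ≤
      C * ∑ α : HexMidEdgeSAW ((Λ₀ \ (β₀ ++ [p₀]).toFinset) \ (p₀' :: β₀').toFinset) s(p₀, c₁)
        s(c_L, p₀'), (if α.verts.IsChain (hexDomainGraph Ω δ).Adj then x ^ α.length else 0)) :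
    ∑ ω ∈ ((Finset.univ : Finset (HexDomainSAW Ω δ a b)).filter (fun ω => ∃ c : List HexVertex,
        ∃ hc : c ≠ [], ω.walk.support = β₀ ++ p₀ :: (c ++ p₀' :: β₀') ∧ c.head hc = c₁ ∧
          c.getLast hc = c_L)).filter (fun ω => E ω.walk.support), x ^ ω.vertexCount ≤
      C * ∑ ω ∈ (Finset.univ : Finset (HexDomainSAW Ω δ a b)).filter (fun ω => ∃ c : List HexVertex,
        ∃ hc : c ≠ [], ω.walk.support = β₀ ++ p₀ :: (c ++ p₀' :: β₀') ∧ c.head hc = c₁ ∧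
          c.getLast hc = c_L), x ^ ω.vertexCount := by
  set e := β₀.length + β₀'.length + 2 with he
  have hxe : 0 ≤ x ^ e := pow_nonneg hx _
  -- both sides as sums of functions of the support over the fibre, then over the arcs
  rw [Finset.sum_filter]
  have hw₂ := sum_fibre_eq_sum_arcs ω₀ hc₀ h₀ hc₁ hcL Λ₀ hΛ₀ (fun L => if E L then x ^ L.length else 0)
  have hw₁ := sum_fibre_eq_sum_arcs ω₀ hc₀ h₀ hc₁ hcL Λ₀ hΛ₀ (fun L => x ^ L.length)
  simp only [vertexCount_eq_length_support]
  rw [hw₂, hw₁]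
  simp only [length_glued, pow_add x (β₀.length + β₀'.length + 2)]
  -- the arc sums
  have h1 : ∑ α ∈ Finset.univ.filter (fun α : HexMidEdgeSAW ((Λ₀ \ (β₀ ++ [p₀]).toFinset) \
      (p₀' :: β₀').toFinset) s(p₀, c₁) s(c_L, p₀') => α.verts.IsChain (hexDomainGraph Ω δ).Adj),
        (if E (β₀ ++ p₀ :: (α.verts ++ p₀' :: β₀')) then x ^ e * x ^ α.verts.length else 0) ≤
      x ^ e * ∑ α : HexMidEdgeSAW ((Λ₀ \ (β₀ ++ [p₀]).toFinset) \ (p₀' :: β₀').toFinset) s(p₀, c₁)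
        s(c_L, p₀'), (if α.verts.IsChain (hexDomainGraph Ω δ).Adj ∧ A α then x ^ α.length else 0) := by
    rw [Finset.mul_sum, Finset.sum_filter]
    refine Finset.sum_le_sum fun α _ => ?_
    by_cases hch : α.verts.IsChain (hexDomainGraph Ω δ).Adj
    · by_cases hE : E (β₀ ++ p₀ :: (α.verts ++ p₀' :: β₀'))
      · have hA : A α := hEA α hch hE
        simp [hch, hE, hA, HexMidEdgeSAW.length]
      · simp only [hch, hE, if_true, if_false]
        split_ifs <;> positivity
    · simp [hch]
  have h2 : C * ∑ α ∈ Finset.univ.filter (fun α : HexMidEdgeSAW ((Λ₀ \ (β₀ ++ [p₀]).toFinset) \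
      (p₀' :: β₀').toFinset) s(p₀, c₁) s(c_L, p₀') => α.verts.IsChain (hexDomainGraph Ω δ).Adj),
        x ^ e * x ^ α.verts.length =
      x ^ e * (C * ∑ α : HexMidEdgeSAW ((Λ₀ \ (β₀ ++ [p₀]).toFinset) \ (p₀' :: β₀').toFinset)
        s(p₀, c₁) s(c_L, p₀'),
          (if α.verts.IsChain (hexDomainGraph Ω δ).Adj then x ^ α.length else 0)) := by
    rw [Finset.sum_filter, Finset.mul_sum, Finset.mul_sum, Finset.mul_sum]
    refine Finset.sum_congr rfl fun α _ => ?_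
    split_ifs <;> simp [HexMidEdgeSAW.length]; ring
  rw [h2]
  exact h1.trans (mul_le_mul_of_nonneg_left hAC hxe)

/-- Transferring a bound between weighted indicator sums along an equivalent base predicate and a
weaker event (used to pass from arcs of an enlarged graph / smaller threshold to the arcs one
needs). [folklore] -/
theorem sum_ite_and_le_of_iff_of_imp {ι : Type*} [Fintype ι] {P P' Q Q' : ι → Prop}
    [DecidablePred P] [DecidablePred P'] [DecidablePred Q] [DecidablePred Q'] (f : ι → ℝ)
    (hf : ∀ i, 0 ≤ f i) (hP : ∀ i, P' i ↔ P i) (hQ : ∀ i, Q i → Q' i) {K : ℝ}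
    (h : ∑ i, (if P' i ∧ Q' i then f i else 0) ≤ K * ∑ i, (if P' i then f i else 0)) :
    ∑ i, (if P i ∧ Q i then f i else 0) ≤ K * ∑ i, (if P i then f i else 0) := by
  have e : ∑ i, (if P' i then f i else 0) = ∑ i, (if P i then f i else 0) :=
    Finset.sum_congr rfl fun i _ => if_congr (hP i) rfl rfl
  rw [← e]
  refine le_trans (Finset.sum_le_sum fun i _ => ?_) h
  by_cases hi : P i ∧ Q i
  · rw [if_pos hi, if_pos ⟨(hP i).2 hi.1, hQ i hi.2⟩]
  · rw [if_neg hi]; split_ifs <;> simp [hf i]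

end FibreBound

end Literature.Probability.RandomPlanarGeometry.SAW

end
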